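import Literature.AlgebraicGeometry.Motives.ProjectiveSpaceFunctionField
import Literature.AlgebraicGeometry.Motives.FunctionFieldOver
import HarnessLib

/-!
# Pulling back the coordinate ratios `x_j/x_l` along the morphism to `ℙ^d` defined by generating
# sections: `ψ^♯(x_j/x_l) = s_j/s_l`

Let `G` be generating-sections data on an integral scheme `X` indexed by `Fin (d + 1)`
(`Motives/MorphismsToProjectiveSpace`: opens `U l = X_{s_l}` and ratios `s_j/s_l ∈ Γ(U l, 𝒪_X)`)
and `ψ = G.toProj f₀ : X → ℙ^d_K` the morphism it defines (Hartshorne II Thm. 7.1 (b)). This file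
proves the part of the universal property of `ℙ^d` that the function-field calculus of
`Motives/ProjectiveSpaceFunctionField` needs:

* `GeneratingSections.app_sec` — over the chart `D₊(x_l)`, `ψ^*` of the section of a degree-zero
  fraction `a ∈ (K[x]_{(x_l)})₀` (`ProjSpace.sec l a`) is the chart ring map
  `(K[x]_{(x_l)})₀ → Γ(X_{s_l}, 𝒪)`, `x_j/x_l ↦ s_j/s_l`, applied to `a`
  (`GeneratingSections.chartRingHom`); in particular
* `GeneratingSections.functionFieldMap_toProj_awayToFunctionField_frac` — **`ψ^♯(x_j/x_l) = s_j/s_l`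
  in `K(X)`** for `ψ` dominant (Hartshorne II Thm. 7.1: "`s_i = φ^*(x_i)`");
* `GeneratingSections.isAffineHom_toProj` — `ψ` is an affine morphism when the `X_{s_l}` are affine
  (`ψ⁻¹ D₊(x_l) = X_{s_l}`, affineness is local on the target).

Also the naturality `f^*(V.topIso τ) = (f⁻¹V).topIso ((f|_V)^* τ)` of Mathlib's
`Scheme.Opens.topIso` (`Scheme.Hom.app_topIso_hom`).

## References

* R. Hartshorne, *Algebraic Geometry*, GTM 52 (1977), II Thm. 7.1. [Hartshorne1977]
-/

universe u

open CategoryTheory AlgebraicGeometry Limits HomogeneousLocalization TopologicalSpace Opposite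
open MvPolynomial (X C)
open Literature.AlgebraicGeometry.Motives.Segre Literature.AlgebraicGeometry.Motives.RatFn

attribute [local instance] MvPolynomial.gradedAlgebra

noncomputable section

namespace Literature.AlgebraicGeometry.Motives

/-! ### Naturality of `topIso` along restriction of morphisms -/

/-- **Naturality of `Scheme.Opens.topIso`**: for `f : X → Y`, an open `V ⊆ Y` and a section
`τ ∈ Γ(V, 𝒪_V)`, pulling back `τ` read in `Γ(Y, V)` along `f` is reading the pullback of `τ` along
the restricted morphism `f|_V : f⁻¹V → V` in `Γ(X, f⁻¹V)`. [folklore] -/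
theorem Scheme.Hom.app_topIso_hom {X Y : Scheme.{u}} (f : X ⟶ Y) (V : Y.Opens) (τ : Γ(V, ⊤)) :
    f.app V (V.topIso.hom τ) = (f ⁻¹ᵁ V).topIso.hom ((f ∣_ V).appTop τ) := by
  rw [morphismRestrict_appTop]
  simp only [Scheme.Opens.topIso_hom]
  have key : Y.presheaf.map (eqToHom V.ι_image_top.symm).op ≫ f.app V =
      (f.app (V.ι ''ᵁ ⊤) ≫ X.presheaf.map (eqToHom (image_morphismRestrict_preimage f V ⊤)).op) ≫
        X.presheaf.map (eqToHom (f ⁻¹ᵁ V).ι_image_top.symm).op := by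
    rw [f.naturality, Category.assoc]
    erw [← X.presheaf.map_comp]
    congr 1
  have h := congrArg (fun φ => φ.hom τ) key
  simp only [CommRingCat.hom_comp, RingHom.coe_comp, Function.comp_apply] at h
  exact h

namespace GeneratingSections

variable {d : ℕ} {K : Type u} [Field K] {Y : Scheme.{u}} (G : GeneratingSections (Fin (d + 1)) Y)
  (f₀ : Y ⟶ Spec (.of K))

/-- The preimage of the chart `ProjSpace.U l = D₊(x_l)` under `G.toProj f₀` is `G.U l = Y_{s_l}`
(`toProj_preimage_basicOpen`). [folklore] -/
theorem toProj_preimage_U (l : Fin (d + 1)) : G.toProj f₀ ⁻¹ᵁ ProjSpace.U l = G.U l :=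
  G.toProj_preimage_basicOpen f₀ l

/-- **`Y → ℙ^d` defined by generating sections with affine non-vanishing loci is an affine
morphism** (`ψ⁻¹ D₊(x_l) = Y_{s_l}`; affineness is local on the target, Mathlib
`HasAffineProperty` for `IsAffineHom`). [folklore] -/
theorem isAffineHom_toProj (hU : ∀ l, IsAffineOpen (G.U l)) : IsAffineHom (G.toProj f₀) := by
  refine (HasAffineProperty.iff_of_iSup_eq_top (P := @IsAffineHom) (f := G.toProj f₀)
    (fun l : Fin (d + 1) => ⟨Proj.basicOpen (grading (Fin (d + 1)) K) (X l),
      Proj.isAffineOpen_basicOpen _ _ (X_mem K l) zero_lt_one⟩)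
    (Proj.iSup_basicOpen_eq_top (grading (Fin (d + 1)) K) (fun l : Fin (d + 1) => (X l))
      (irrelevant_le_span_X (Fin (d + 1)) K))).2 fun l => ?_
  change IsAffineOpen (G.toProj f₀ ⁻¹ᵁ Proj.basicOpen (grading (Fin (d + 1)) K) (X l))
  rw [G.toProj_preimage_basicOpen f₀ l]
  exact hU l

/-- The inclusion of `ψ⁻¹ D₊(x_l)` lands in the chart `G.U l` (they are equal). [folklore] -/
theorem top_le_preimage_U (l : Fin (d + 1)) :
    ⊤ ≤ (G.toProj f₀ ⁻¹ᵁ ProjSpace.U l).ι ⁻¹ᵁ G.U l := by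
  rw [← G.toProj_preimage_U f₀ l]
  exact top_le_ι_preimage _

/-- Over `D₊(x_l)`, the restriction of `ψ = G.toProj f₀` followed by the chart isomorphism
`D₊(x_l) ≅ Spec (K[x]_{(x_l)})₀` is `Spec` of the chart ring map
`(K[x]_{(x_l)})₀ → Γ(ψ⁻¹ D₊(x_l), 𝒪)`, `x_j/x_l ↦ s_j/s_l` (both lift `ψ⁻¹D₊(x_l) → Y → ℙ^d` through the
open immersion `Spec (K[x]_{(x_l)})₀ → ℙ^d`; `GeneratingSections.comp_toProj`). [folklore] -/
theorem morphismRestrict_toProj_chartLift (l : Fin (d + 1)) :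
    (G.toProj f₀ ∣_ ProjSpace.U l) ≫ chartLift (𝟙 (ProjSpace.P d K)) l =
      Scheme.toSpecΓ (G.toProj f₀ ⁻¹ᵁ ProjSpace.U l) ≫ Spec.map (CommRingCat.ofHom
        (G.chartRingHom f₀ l (G.toProj f₀ ⁻¹ᵁ ProjSpace.U l).ι (G.top_le_preimage_U f₀ l))) := by
  rw [← cancel_mono (chartι K l), Category.assoc, chartLift_chartι, ← Category.assoc,
    morphismRestrict_ι, Category.comp_id, Category.assoc]
  exact G.comp_toProj f₀ _ (G.top_le_preimage_U f₀ l)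

omit G f₀ in
/-- Pulling back along the unit `T → Spec Γ(T, 𝒪_T)` is the identity on global sections. [folklore] -/
theorem pull_toSpecΓ (T : Scheme.{u}) (r : Γ(T, ⊤)) : pull T.toSpecΓ r = r := by
  rw [pull_apply, Scheme.toSpecΓ_appTop, ← CommRingCat.comp_apply, Iso.inv_hom_id]
  rfl

/-- **`ψ^*` of the section of a degree-zero fraction is the chart ring map applied to it**:
`ψ^* (sec l a) = chartRingHom a` read in `Γ(Y, ψ⁻¹ D₊(x_l))`. [folklore] -/
theorem app_sec (l : Fin (d + 1)) (a : Away (grading (Fin (d + 1)) K) (X l)) :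
    (G.toProj f₀).app (ProjSpace.U l) (ProjSpace.sec l a) =
      (G.toProj f₀ ⁻¹ᵁ ProjSpace.U l).topIso.hom
        (G.chartRingHom f₀ l (G.toProj f₀ ⁻¹ᵁ ProjSpace.U l).ι (G.top_le_preimage_U f₀ l) a) := by
  rw [ProjSpace.sec, Scheme.Hom.app_topIso_hom]
  congr 1
  have h1 : (G.toProj f₀ ∣_ ProjSpace.U l).appTop (pull (chartLift (𝟙 (ProjSpace.P d K)) l) a) =
      pull ((G.toProj f₀ ∣_ ProjSpace.U l) ≫ chartLift (𝟙 (ProjSpace.P d K)) l) a := by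
    rw [pull_comp]; rfl
  rw [h1, morphismRestrict_toProj_chartLift, pull_SpecMap', RingHom.comp_apply, pull_toSpecΓ]
  rfl

omit G in
/-- For `W ≤ V`, the top open of the open subscheme `W` maps into `V`. [folklore] -/
theorem top_le_ι_preimage_of_le {V W : Y.Opens} (h : W ≤ V) :
    (⊤ : (W : Scheme.{u}).Opens) ≤ W.ι ⁻¹ᵁ V :=
  (top_le_ι_preimage W).trans ((Opens.map W.ι.base).map (homOfLE h)).le

omit G in
/-- Transporting along `W.topIso` a section restricted along `W.ι` from a larger open `V ⊇ W` is
restricting it to `W`. [folklore] -/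
theorem topIso_hom_res {V W : Y.Opens} (h : W ≤ V) (r : Γ(Y, V)) :
    W.topIso.hom (res W.ι V (top_le_ι_preimage_of_le h) r) = Y.presheaf.map (homOfLE h).op r := by
  simp only [res, Scheme.Opens.topIso_hom, Scheme.Opens.ι_appLE]
  rw [← CommRingCat.comp_apply]
  erw [← Y.presheaf.map_comp]
  rfl

variable [IsIntegral Y]

/-- **`ψ^♯(x_j/x_l) = s_j/s_l` in `K(Y)`** for the (dominant) morphism `ψ = G.toProj f₀ : Y → ℙ^d`
defined by generating sections (Hartshorne II Thm. 7.1 (b): "`𝓛 ≅ φ^*𝒪(1)` and `s_i = φ^*(x_i)`"),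
where `x_j/x_l` is the rational function `ProjSpace.awayToFunctionField l (x_j/x_l)` on `ℙ^d` and
`s_j/s_l` the rational function of the ratio `G.ratio l j ∈ Γ(Y_{s_l}, 𝒪)`.
[cite: Hartshorne1977, II Thm. 7.1 (b)] -/
theorem functionFieldMap_toProj_awayToFunctionField_frac [IsDominant (G.toProj f₀)] (l j : Fin (d + 1))
    (h : genericPoint Y ∈ G.U l) :
    functionFieldMap (G.toProj f₀) (ProjSpace.awayToFunctionField l (frac K l j)) =
      ofSection h (G.ratio l j) := by
  have hW : genericPoint Y ∈ G.toProj f₀ ⁻¹ᵁ ProjSpace.U l := by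
    rw [G.toProj_preimage_U f₀ l]; exact h
  rw [ProjSpace.awayToFunctionField_apply,
    functionFieldMap_ofSection (G.toProj f₀) (ProjSpace.genericPoint_mem_U l), app_sec,
    chartRingHom_frac]
  have hle : G.toProj f₀ ⁻¹ᵁ ProjSpace.U l ≤ G.U l := (G.toProj_preimage_U f₀ l).le
  change ofSection _ ((G.toProj f₀ ⁻¹ᵁ ProjSpace.U l).topIso.hom
    (res (G.toProj f₀ ⁻¹ᵁ ProjSpace.U l).ι (G.U l) _ (G.ratio l j))) = _
  rw [show res (G.toProj f₀ ⁻¹ᵁ ProjSpace.U l).ι (G.U l) (G.top_le_preimage_U f₀ l) (G.ratio l j) =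
      res (G.toProj f₀ ⁻¹ᵁ ProjSpace.U l).ι (G.U l) (top_le_ι_preimage_of_le hle)
        (G.ratio l j) from rfl, topIso_hom_res hle]
  exact ofSection_map (homOfLE hle) _ _

end GeneratingSections

end Literature.AlgebraicGeometry.Motives

end
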